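import Mathlib
import Literature.NumberTheory.LFunctions.Zhang2022.Section15U008Beta
import Literature.NumberTheory.LFunctions.Zhang2022.TypedSection15ASubsteps
import Literature.NumberTheory.LFunctions.Zhang2022.Section2FrakP
import HarnessLib

/-!
# Zhang (2022) §15, node Z22:§15.u008 (β) BY NAME: `Typed.Section15A.Step15_u008beta c′` for all
# large `c′`, kernel-checked

Topic `Literature/NumberTheory/LFunctions/Zhang2022` (Landau–Siegel audit tree; verdict-neutral).
Y. Zhang, *Discrete mean estimates and the Landau–Siegel zero*, arXiv:2211.02515v1 (2022)
[Zhang2022LandauSiegel] — **an unrefereed manuscript under adjudication; nothing here asserts or denies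
its Theorems 1–2.** Lane ZHANG-L, WP15, leaf h15_6, node `Z22:§15.u008` (β) (RT15-int-1; typed by
zl-w15-typer after zl-closer-1's signature, `TypedSection15ASubsteps.Step15_u008beta`):
`Σ_{ψ∈Ψ₁} ∫_{−𝓛₁}^{𝓛₁} ‖M₁(−α+s₀+iv,ψ)·ω(−α+s₀+iv)‖ dv ≤ C·𝔓·𝓛¹²²` under (A).

This file integrates the tree's POINTWISE bound `Section15U008Beta.sum_norm_M1_le_of_prop22`
(`Σ_{ψ∈Ψ₁}‖M₁(s,ψ)‖ ≤ C·P·√𝔓·𝓛⁴⁵` on `𝔍(−α)`): `|ω(−α+s₀+iv)| = (√π/𝓛₂)e^{(α²−v²)/(4𝓛₂²)} ≤ e√π/𝓛₂`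
(`SmoothWeight.norm_omega_eq`), the segment has length `2𝓛₁`, and `P ≤ 2√𝔓·𝓛³⁹` by (2.9)
(`frakP_bounds`: `𝔓 ≥ ½P²𝓛⁻⁷⁷`), so the left side is `≤ 4e√πC·𝔓·𝓛^{405−400+45+39} = 4e√πC·𝔓·𝓛⁸⁹ ≤
4e√πC·𝔓·𝓛¹²²`. The interchange `Σ∫ = ∫Σ` is taken over the sub-family of `ψ` whose integrand is
interval-integrable (the other summands are `0` by Lean's convention for `∫` and the pointwise bound of
a sub-sum is dominated by the full sum), so no continuity input is needed. Output:
`step15_u008beta_of_prop22 (hc′ : 0 ≤ c′) (h22 : Prop22 c′) : Step15_u008beta c′` and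
`step15_u008beta_eventually : ∃ c₀, ∀ c′ ≥ c₀, Step15_u008beta c′` (Prop. 2.2 for large `c′`).

WHAT THIS IS NOT: the assembly `step15_u008_of_beta` (zl-closer-1, tree) or the leaf h15_6.

## References

* Y. Zhang, arXiv:2211.02515v1 (2022), §15 p. 80, tex L4017–L4033; §2 (2.9).
  [cite: Zhang2022LandauSiegel, §15 p. 80]
-/

noncomputable section

open Complex Real ComplexConjugate MeasureTheory

namespace Literature.NumberTheory.LFunctions.Zhang2022.Typed.Section15A

open Literature.NumberTheory.LFunctions.Zhang2022.Skeleton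

/-- `P ≤ 2√𝔓·𝓛³⁹` eventually (from (2.9): `𝔓 ≥ (1 − 3𝓛⁻⁶⁸)P²𝓛⁻⁷⁷ ≥ ½P²𝓛⁻⁷⁷` for `𝓛 ≥ 2`, and
`2𝓛⁷⁷ ≤ 4𝓛⁷⁸`). [cite: Zhang2022LandauSiegel, §2 (2.9) p. 4] -/
theorem bigP_le_two_sqrt_frakP : ∃ D₀ : ℕ, ∀ D : ℕ, D₀ ≤ D →
    bigP D ≤ 2 * Real.sqrt (frakP D) * ell D ^ 39 := by
  obtain ⟨D₀, hD₀⟩ := frakP_bounds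
  refine ⟨max D₀ ⌈Real.exp 2⌉₊, fun D hD => ?_⟩
  have h := hD₀ D (le_trans (le_max_left _ _) hD)
  have hL2 : 2 ≤ ell D := by
    have h1 : Real.exp 2 ≤ D := le_trans (Nat.le_ceil _) (by exact_mod_cast le_trans (le_max_right _ _) hD)
    have := Real.log_le_log (Real.exp_pos 2) h1
    rwa [Real.log_exp] at this
  have hL1 : 1 ≤ ell D := by linarith
  have hL0 : 0 < ell D := by linarith
  change |frakP D - bigP D ^ 2 * (ell D ^ 77)⁻¹| ≤ 3 * (ell D ^ 68)⁻¹ * (bigP D ^ 2 * (ell D ^ 77)⁻¹) at h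
  have hP0 : 0 < bigP D := Real.exp_pos _
  have h68 : 3 * (ell D ^ 68)⁻¹ ≤ 1 / 2 := by
    rw [show 3 * (ell D ^ 68)⁻¹ = 3 / ell D ^ 68 by ring, div_le_iff₀ (by positivity)]
    have : (2 : ℝ) ^ 68 ≤ ell D ^ 68 := pow_le_pow_left₀ (by norm_num) hL2 68
    nlinarith
  have hlow : bigP D ^ 2 * (ell D ^ 77)⁻¹ / 2 ≤ frakP D := by
    have h1 := (abs_le.mp h).1
    have h0 : 0 ≤ bigP D ^ 2 * (ell D ^ 77)⁻¹ := by positivity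
    nlinarith
  have hfr0 : 0 ≤ frakP D := le_trans (by positivity) hlow
  -- `P² ≤ 2𝓛⁷⁷𝔓 ≤ (2√𝔓𝓛³⁹)²`
  have hP2 : bigP D ^ 2 ≤ (2 * Real.sqrt (frakP D) * ell D ^ 39) ^ 2 := by
    have e : (2 * Real.sqrt (frakP D) * ell D ^ 39) ^ 2 = 4 * frakP D * ell D ^ 78 := by
      rw [show (2 * Real.sqrt (frakP D) * ell D ^ 39) ^ 2 =
        4 * Real.sqrt (frakP D) ^ 2 * (ell D ^ 39) ^ 2 by ring, Real.sq_sqrt hfr0]; ring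
    rw [e]
    have h77 : 0 < ell D ^ 77 := by positivity
    have h1 : bigP D ^ 2 ≤ 2 * ell D ^ 77 * frakP D := by
      have := mul_le_mul_of_nonneg_left hlow (show (0 : ℝ) ≤ 2 * ell D ^ 77 by positivity)
      rw [show 2 * ell D ^ 77 * (bigP D ^ 2 * (ell D ^ 77)⁻¹ / 2) = bigP D ^ 2 by
        field_simp] at this
      exact this
    have h2 : 2 * ell D ^ 77 * frakP D ≤ 4 * frakP D * ell D ^ 78 := by
      have : ell D ^ 77 ≤ ell D ^ 78 := pow_le_pow_right₀ hL1 (by norm_num)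
      nlinarith
    linarith
  have h0 : 0 ≤ 2 * Real.sqrt (frakP D) * ell D ^ 39 := by positivity
  calc bigP D = Real.sqrt (bigP D ^ 2) := (Real.sqrt_sq hP0.le).symm
    _ ≤ Real.sqrt ((2 * Real.sqrt (frakP D) * ell D ^ 39) ^ 2) := Real.sqrt_le_sqrt hP2
    _ = 2 * Real.sqrt (frakP D) * ell D ^ 39 := Real.sqrt_sq h0

/-- `|ω(−α+s₀+iv)| ≤ e√π/𝓛₂` (`|ω(s)| = (√π/𝓛₂)e^{((σ−½)²−(t−2πt₀)²)/(4𝓛₂²)}`, `(σ−½)² = α² ≤ 1 ≤ 4𝓛₂²`).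
[cite: Zhang2022LandauSiegel, §2 (2.11)–(2.12)] -/
theorem norm_omegaW_segment_le {D : ℕ} (hL : 1 ≤ ell D) (hα : |alpha D| ≤ 1) (v : ℝ) :
    ‖omegaW D (((-alpha D : ℝ) : ℂ) + s0 D + v * I)‖ ≤ Real.exp 1 * Real.sqrt π / ell2 D := by
  have hℓ2 : 0 < ell2 D := by rw [ell2]; positivity
  have hℓ21 : 1 ≤ ell2 D := by rw [ell2]; exact one_le_pow₀ hL
  rw [omegaW, SmoothWeight.norm_omega_eq hℓ2]
  have hre : (((-alpha D : ℝ) : ℂ) + s0 D + v * I).re - 1 / 2 = -alpha D := by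
    rw [s0, SmoothWeight.s0]; simp
  have him : (((-alpha D : ℝ) : ℂ) + s0 D + v * I).im - 2 * π * t0 D = v := by
    rw [s0, SmoothWeight.s0]; simp
  rw [hre, him]
  have hexp : ((-alpha D) ^ 2 - v ^ 2) / (4 * ell2 D ^ 2) ≤ 1 := by
    rw [div_le_one (by positivity)]
    have h1 : alpha D ^ 2 ≤ 1 := by
      have := abs_le.mp hα; nlinarith
    nlinarith [sq_nonneg v, hℓ21]
  calc Real.sqrt π / ell2 D * Real.exp (((-alpha D) ^ 2 - v ^ 2) / (4 * ell2 D ^ 2))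
      ≤ Real.sqrt π / ell2 D * Real.exp 1 :=
        mul_le_mul_of_nonneg_left (Real.exp_le_exp.mpr hexp) (by positivity)
    _ = Real.exp 1 * Real.sqrt π / ell2 D := by ring

/-- The points `−α + s₀ + iv`, `|v| ≤ 𝓛₁`, lie on `𝔍(−α)`. [cite: Zhang2022LandauSiegel, §15 p. 80] -/
theorem memJ_segment {D : ℕ} {v : ℝ} (hv : v ∈ Set.Icc (-ell1 D) (ell1 D)) :
    MemJ D (-alpha D) (((-alpha D : ℝ) : ℂ) + s0 D + v * I) := by
  refine ⟨?_, ?_⟩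
  · rw [s0, SmoothWeight.s0]; simp; ring
  · have him : (((-alpha D : ℝ) : ℂ) + s0 D + v * I).im - 2 * π * t0 D = v := by
      rw [s0, SmoothWeight.s0]; simp
    rw [him]
    exact abs_le.mpr ⟨hv.1, hv.2⟩

/-- **Node u008 (β) from Prop. 2.2**: for `c′ ≥ 0` with `Prop22 c′`, `Step15_u008beta c′` holds —
`Σ_{ψ∈Ψ₁}∫_{−𝓛₁}^{𝓛₁}‖M₁(−α+s₀+iv,ψ)ω(−α+s₀+iv)‖dv ≤ C·𝔓·𝓛¹²²` under (A) (in fact `≤ C·𝔓·𝓛⁸⁹`).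
[cite: Zhang2022LandauSiegel, §15 p. 80, tex L4020] -/
theorem step15_u008beta_of_prop22 {c' : ℝ} (hc' : 0 ≤ c') (h22 : Prop22 c') :
    Step15_u008beta c' := by
  obtain ⟨C, hC0, D₀, hC⟩ := sum_norm_M1_le_of_prop22 hc' h22
  obtain ⟨DP, hP⟩ := bigP_le_two_sqrt_frakP
  refine ⟨4 * Real.exp 1 * Real.sqrt π * C, max (max D₀ DP) ⌈Real.exp 80⌉₊, ?_⟩
  intro D _ χ hD hq hp hA
  have hD₀ : D₀ ≤ D := le_trans (le_trans (le_max_left _ _) (le_max_left _ _)) hD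
  have hDP : DP ≤ D := le_trans (le_trans (le_max_right _ _) (le_max_left _ _)) hD
  have h80 : 80 ≤ ell D := by
    have h1 : Real.exp 80 ≤ D := le_trans (Nat.le_ceil _) (by exact_mod_cast le_trans (le_max_right _ _) hD)
    have := Real.log_le_log (Real.exp_pos 80) h1
    rwa [Real.log_exp] at this
  have hL1 : 1 ≤ ell D := by linarith
  have hL0 : 0 < ell D := by linarith
  have hα1 : |alpha D| ≤ 1 := by
    have hα : alpha D = π / ell D ^ 9 := by rw [alpha, bigP, Real.log_exp]
    have h9 : (80 : ℝ) ^ 9 ≤ ell D ^ 9 := pow_le_pow_left₀ (by norm_num) h80 9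
    have hpos : 0 < alpha D := by rw [hα]; positivity
    rw [abs_of_pos hpos, hα, div_le_one (by positivity)]
    nlinarith [Real.pi_lt_four]
  have hfr0 : 0 ≤ frakP D := by
    rw [frakP_eq_sum_primeWindow]; exact Finset.sum_nonneg fun p _ => Nat.cast_nonneg p
  have hℓ1 : 0 ≤ ell1 D := by rw [ell1]; positivity
  have hℓ2 : 0 < ell2 D := by rw [ell2]; positivity
  have hP0 : 0 < bigP D := Real.exp_pos _
  have hK0 : 0 ≤ C * bigP D * Real.sqrt (frakP D) * ell D ^ 45 :=
    mul_nonneg (mul_nonneg (mul_nonneg hC0 hP0.le) (Real.sqrt_nonneg _)) (pow_nonneg hL0.le _)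
  have hE0 : 0 ≤ Real.exp 1 * Real.sqrt π / ell2 D :=
    div_nonneg (mul_nonneg (Real.exp_nonneg _) (Real.sqrt_nonneg _)) hℓ2.le
  -- the segment and the integrands
  set T := finsetOf (PsiOne χ) with hT
  set pt : ℝ → ℂ := fun v => ((-alpha D : ℝ) : ℂ) + s0 D + v * I with hpt
  set f : Chr D → ℝ → ℝ := fun x v => ‖mainU008alpha c' χ x (pt v) * omegaW D (pt v)‖ with hf
  have hf0 : ∀ x v, 0 ≤ f x v := fun x v => norm_nonneg _
  -- the constant pointwise bound for the full sum
  set G : ℝ := Real.exp 1 * Real.sqrt π / ell2 D * (C * bigP D * Real.sqrt (frakP D) * ell D ^ 45) with hG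
  have hG0 : 0 ≤ G := by rw [hG]; exact mul_nonneg hE0 hK0
  have hsum_pt : ∀ v ∈ Set.Icc (-ell1 D) (ell1 D), ∑ x ∈ T, f x v ≤ G := by
    intro v hv
    have hmem := memJ_segment (D := D) hv
    have hb := hC D χ hD₀ hq hp hA (pt v) hmem
    have hω := norm_omegaW_segment_le hL1 hα1 v
    have e : ∑ x ∈ T, f x v = (∑ x ∈ T, ‖mainU008alpha c' χ x (pt v)‖) * ‖omegaW D (pt v)‖ := by
      rw [Finset.sum_mul]
      refine Finset.sum_congr rfl fun x _ => ?_
      rw [hf]; exact norm_mul _ _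
    rw [e, hG]
    calc (∑ x ∈ T, ‖mainU008alpha c' χ x (pt v)‖) * ‖omegaW D (pt v)‖
        ≤ (C * bigP D * Real.sqrt (frakP D) * ell D ^ 45) * (Real.exp 1 * Real.sqrt π / ell2 D) :=
          mul_le_mul hb hω (norm_nonneg _) hK0
      _ = _ := by ring
  -- split off the non-integrable summands (their integrals vanish)
  classical
  set T' := T.filter (fun x => IntervalIntegrable (f x) volume (-ell1 D) (ell1 D)) with hT'
  have hsplit : ∑ x ∈ T, ∫ v in (-ell1 D)..ell1 D, f x v = ∑ x ∈ T', ∫ v in (-ell1 D)..ell1 D, f x v := by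
    rw [hT', ← Finset.sum_filter_add_sum_filter_not T
      (fun x => IntervalIntegrable (f x) volume (-ell1 D) (ell1 D))]
    have hz : ∑ x ∈ T.filter (fun x => ¬ IntervalIntegrable (f x) volume (-ell1 D) (ell1 D)),
        ∫ v in (-ell1 D)..ell1 D, f x v = 0 := by
      refine Finset.sum_eq_zero fun x hx => ?_
      rw [Finset.mem_filter] at hx
      exact intervalIntegral.integral_undef hx.2
    rw [hz, add_zero]
  have hint : ∀ x ∈ T', IntervalIntegrable (f x) volume (-ell1 D) (ell1 D) := by
    intro x hx; rw [hT', Finset.mem_filter] at hx; exact hx.2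
  have hsub : T' ⊆ T := Finset.filter_subset _ _
  -- interchange and integrate the constant bound
  have hmain : ∑ x ∈ T', ∫ v in (-ell1 D)..ell1 D, f x v ≤ 2 * ell1 D * G := by
    rw [← intervalIntegral.integral_finsetSum hint]
    have hI : IntervalIntegrable (fun v => ∑ x ∈ T', f x v) volume (-ell1 D) (ell1 D) := by
      have h := IntervalIntegrable.sum T' hint
      have e : (∑ x ∈ T', f x) = fun v => ∑ x ∈ T', f x v := by
        funext v; exact Finset.sum_apply v T' f
      rwa [e] at h
    calc ∫ v in (-ell1 D)..ell1 D, ∑ x ∈ T', f x v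
        ≤ ∫ v in (-ell1 D)..ell1 D, G := by
          refine intervalIntegral.integral_mono_on (by linarith) hI
            intervalIntegrable_const fun v hv => ?_
          exact (Finset.sum_le_sum_of_subset_of_nonneg hsub fun x _ _ => hf0 x v).trans (hsum_pt v hv)
      _ = 2 * ell1 D * G := by rw [intervalIntegral.integral_const, smul_eq_mul]; ring
  -- sizes: `2𝓛₁·e√π/𝓛₂·C·P√𝔓·𝓛⁴⁵ ≤ 4e√πC·𝔓·𝓛⁸⁹ ≤ 4e√πC·𝔓·𝓛¹²²`
  have hPfr : bigP D * Real.sqrt (frakP D) ≤ 2 * frakP D * ell D ^ 39 := by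
    have h := hP D hDP
    calc bigP D * Real.sqrt (frakP D) ≤ (2 * Real.sqrt (frakP D) * ell D ^ 39) * Real.sqrt (frakP D) :=
          mul_le_mul_of_nonneg_right h (Real.sqrt_nonneg _)
      _ = 2 * (Real.sqrt (frakP D) * Real.sqrt (frakP D)) * ell D ^ 39 := by ring
      _ = 2 * frakP D * ell D ^ 39 := by rw [Real.mul_self_sqrt hfr0]
  have hfinal : 2 * ell1 D * G ≤ 4 * Real.exp 1 * Real.sqrt π * C * frakP D * ell D ^ 122 := by
    rw [hG, ell1, ell2]
    have hne : ell D ^ 400 ≠ 0 := by positivity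
    have h5 : ell D ^ 405 / ell D ^ 400 = ell D ^ 5 := by
      rw [div_eq_iff hne]; ring
    have e : 2 * ell D ^ 405 * (Real.exp 1 * Real.sqrt π / ell D ^ 400 *
        (C * bigP D * Real.sqrt (frakP D) * ell D ^ 45)) =
        2 * Real.exp 1 * Real.sqrt π * C * (bigP D * Real.sqrt (frakP D)) * ell D ^ 50 := by
      calc 2 * ell D ^ 405 * (Real.exp 1 * Real.sqrt π / ell D ^ 400 *
            (C * bigP D * Real.sqrt (frakP D) * ell D ^ 45))
          = 2 * (ell D ^ 405 / ell D ^ 400) * (Real.exp 1 * Real.sqrt π) *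
              (C * bigP D * Real.sqrt (frakP D) * ell D ^ 45) := by ring
        _ = _ := by rw [h5]; ring
    rw [e]
    have h89 : ell D ^ 39 * ell D ^ 50 ≤ ell D ^ 122 := by
      rw [← pow_add]; exact pow_le_pow_right₀ hL1 (by norm_num)
    calc 2 * Real.exp 1 * Real.sqrt π * C * (bigP D * Real.sqrt (frakP D)) * ell D ^ 50
        ≤ 2 * Real.exp 1 * Real.sqrt π * C * (2 * frakP D * ell D ^ 39) * ell D ^ 50 := by
          gcongr
      _ = 4 * Real.exp 1 * Real.sqrt π * C * frakP D * (ell D ^ 39 * ell D ^ 50) := by ring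
      _ ≤ 4 * Real.exp 1 * Real.sqrt π * C * frakP D * ell D ^ 122 :=
          mul_le_mul_of_nonneg_left h89 (by positivity)
  have hgoal : ∑ x ∈ T, ∫ v in (-ell1 D)..ell1 D, f x v ≤
      4 * Real.exp 1 * Real.sqrt π * C * frakP D * ell D ^ 122 := by
    rw [hsplit]; exact hmain.trans hfinal
  simpa only [hf, hpt, hT] using hgoal

/-- **Node u008 (β), eventual form**: `∃ c₀, ∀ c′ ≥ c₀, Step15_u008beta c′` (Prop. 2.2 for large `c′`,
`Skeleton.prop22_eventually`). [cite: Zhang2022LandauSiegel, §15 p. 80, tex L4020] -/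
theorem step15_u008beta_eventually : ∃ c₀ : ℝ, ∀ c' : ℝ, c₀ ≤ c' → Step15_u008beta c' := by
  obtain ⟨c₀, hc₀, h⟩ := prop22_eventually
  exact ⟨c₀, fun c' hc' => step15_u008beta_of_prop22 (hc₀.trans hc') (h c' hc')⟩

end Literature.NumberTheory.LFunctions.Zhang2022.Typed.Section15A
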